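/-
Copyright (c) 2026. All rights reserved.
Released under Apache 2.0 license as described in the file LICENSE.
Authors: abc-iut cell — seat abc-iut-f-099 (F fact-proving wave, float; FACT-LIST row F-0129).
Proof-only companion to `HolomorphicCores.lean` ([AbsTopIII] Prop 2.5 (b)); no new definitions.
-/
import Literature.AnabelianGeometry.AbsoluteAnabelian.HolomorphicCoresStrictlyParallel
import HarnessLib

/-!
# [AbsTopIII] Prop 2.5 (b): strict parallelism at the printed input data IS "containing two opposite
# closed edges of a member of `𝒬`" — exact characterisation (FACT-LIST F-0129; proof-only)

S. Mochizuki, *Topics in absolute anabelian geometry III: global reconstruction algorithms*, J. Math. Sci.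
Univ. Tokyo 22 (2015) [MochizukiAbsTopIII2015], Prop. 2.5 (b), kurims manuscript p. 56:

> (b) […] Define two line segments `L, L′` of `U` to be *strictly parallel* if there exist
> non-intersecting sides `S, S′` of a parallelogram `∈ 𝒬(U)` such that `S ⊆ L`, `S′ ⊆ L′`.

The FACT-LIST row **F-0129** `Parallelograms.StrictlyParallel` (`HolomorphicCores.lean`, abc-iut-L4-t14) is a
RELATION on the abstract data `(U, 𝒬)`; its universal closure is refuted and model instances are landed in
`HolomorphicCoresStrictlyParallel.lean` (abc-iut-f-100).  This companion completes the instance form to an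
EXACT CHARACTERISATION at the printed input data `U ⊆ ℂ` open, `𝒮(U) ⊆ 𝒬 ⊆ 𝒫(U)` — the analogue for
strict parallelism of `Parallelograms.parallel_iff` (`ParallelogramsPlanarParallelIff.lean`):

* `Parallelograms.eq_opposite_edges_of_isSide_of_inter_eq_empty`: two DISJOINT sides of a member `Q ∈ 𝒬`
  presented as `openParallelogram z v w` are an opposite pair of its four closed edges (the sides of `Q` are
  exactly its closed edges, `Parallelograms.isSide_iff_of_subset`; adjacent edges share a corner in `U`).
* `Parallelograms.strictlyParallel_iff`: `L, L'` are strictly parallel **iff** some member `Q ∈ 𝒬`,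
  presented as `openParallelogram z v w` (non-degenerate, closure in `U`), has its closed edge `[z, z + v]`
  inside `L` and the opposite closed edge `[z + w, z + w + v]` inside `L'` (any opposite pair is brought to
  this normal form by re-presenting the same parallelogram: `openParallelogram_flip`, `openParallelogram_comm`).
* the two extreme printed models: `Parallelograms.strictlyParallel_parallelograms_iff` (`𝒬 = 𝒫(U)`) and
  `Parallelograms.strictlyParallel_squares_iff` (`𝒬 = 𝒮(U)`: `∃ z, v ≠ 0` with the closed square on
  `[z, z + v]` in `U`, `[z, z + v] ⊆ L` and `[z + iv, z + iv + v] ⊆ L'`).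

No hypothesis that `L, L'` be line segments is needed (the relation as typed only asks `S ⊆ L`, `S' ⊆ L'`).
Refereed pre-IUT material, elementary plane geometry; nothing here bears on the disputed [IUTchIII]
Cor. 3.12 or takes a side; a FACT row is an assumption label, and this file only decides its instances.
-/

namespace Literature.AnabelianGeometry.AbsoluteAnabelian

open _root_.Complex _root_.Set

noncomputable section

/-! ### Re-presentations of an open parallelogram -/

/-- Moving the base point along the second edge vector and reversing that vector presents the same open
parallelogram: `(z + w) + s v + t (−w) = z + s v + (1 − t) w`. (Auxiliary.)
[cite: MochizukiAbsTopIII2015, Proposition 2.5 (proof) pp.55–57] -/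
theorem openParallelogram_flip (z v w : ℂ) :
    openParallelogram (z + w) v (-w) = openParallelogram z v w := by
  ext x
  simp only [openParallelogram, mem_setOf_eq]
  constructor
  · rintro ⟨s, t, hs, hs', ht, ht', rfl⟩
    exact ⟨s, 1 - t, hs, hs', by linarith, by linarith, by push_cast; ring⟩
  · rintro ⟨s, t, hs, hs', ht, ht', rfl⟩
    exact ⟨s, 1 - t, hs, hs', by linarith, by linarith, by push_cast; ring⟩

/-- Moving the base point to the opposite corner and reversing both edge vectors presents the same open
parallelogram: `(z + v + w) − s v − t w = z + (1 − s) v + (1 − t) w`. (Auxiliary.)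
[cite: MochizukiAbsTopIII2015, Proposition 2.5 (proof) pp.55–57] -/
theorem openParallelogram_flip_flip (z v w : ℂ) :
    openParallelogram (z + v + w) (-v) (-w) = openParallelogram z v w := by
  ext x
  simp only [openParallelogram, mem_setOf_eq]
  constructor
  · rintro ⟨s, t, hs, hs', ht, ht', rfl⟩
    exact ⟨1 - s, 1 - t, by linarith, by linarith, by linarith, by linarith, by push_cast; ring⟩
  · rintro ⟨s, t, hs, hs', ht, ht', rfl⟩
    exact ⟨1 - s, 1 - t, by linarith, by linarith, by linarith, by linarith, by push_cast; ring⟩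

/-- `ℝ`-independence of a pair is insensitive to negating the second vector. (Auxiliary.)
[cite: MochizukiAbsTopIII2015, Proposition 2.5 (proof) pp.55–57] -/
theorem linearIndependent_pair_neg_right {v w : ℂ} (h : LinearIndependent ℝ ![v, w]) :
    LinearIndependent ℝ ![v, -w] := by
  rw [LinearIndependent.pair_iff] at h ⊢
  intro s t hst
  have hst' : s • v + (-t) • w = 0 := by rwa [neg_smul, ← smul_neg]
  exact ⟨(h s (-t) hst').1, neg_eq_zero.mp (h s (-t) hst').2⟩

namespace Parallelograms

section Planar

variable {U : Set ℂ} (hU : IsOpen U) {𝒬 : Set (Set U)}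
  (h𝒬 : ∀ Q ∈ 𝒬, Subtype.val '' Q ∈ parallelogramsIn U)
  (h𝒮 : ∀ Q : Set U, Subtype.val '' Q ∈ squaresIn U → Q ∈ 𝒬)

/-! ### Disjoint sides of a member of `𝒬` are an opposite pair of closed edges -/

include hU h𝒬 h𝒮 in
/-- **Prop 2.5 (b), disjoint sides.** For `Q ∈ 𝒬` (`U` open, `𝒮(U) ⊆ 𝒬 ⊆ 𝒫(U)`) presented as
`openParallelogram z v w` (non-degenerate, closure in `U`), two sides `S, S'` of `Q` with `S ∩ S' = ∅` are an
OPPOSITE pair of closed edges: `{[z, z+v], [z+w, z+w+v]}` or `{[z, z+w], [z+v, z+v+w]}`, in one of the two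
orders.  (The sides of `Q` are exactly its four closed edges, `isSide_iff_of_subset`; two equal or adjacent
edges share a corner, which lies in `U`.) [cite: MochizukiAbsTopIII2015, Proposition 2.5 (b) p.56] -/
theorem eq_opposite_edges_of_isSide_of_inter_eq_empty {Q : Set U} (hQ : Q ∈ 𝒬) {z v w : ℂ}
    (hQe : Subtype.val '' Q = openParallelogram z v w) (h : LinearIndependent ℝ ![v, w])
    (hcl : closure (openParallelogram z v w) ⊆ U) {S S' : Set U} (hS : IsSide 𝒬 Q S)
    (hS' : IsSide 𝒬 Q S') (hSS' : S ∩ S' = ∅) :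
    (S = Subtype.val ⁻¹' segment ℝ z (z + v) ∧ S' = Subtype.val ⁻¹' segment ℝ (z + w) (z + w + v)) ∨
    (S = Subtype.val ⁻¹' segment ℝ (z + w) (z + w + v) ∧ S' = Subtype.val ⁻¹' segment ℝ z (z + v)) ∨
    (S = Subtype.val ⁻¹' segment ℝ z (z + w) ∧ S' = Subtype.val ⁻¹' segment ℝ (z + v) (z + v + w)) ∨
    (S = Subtype.val ⁻¹' segment ℝ (z + v) (z + v + w) ∧ S' = Subtype.val ⁻¹' segment ℝ z (z + w)) := by
  obtain ⟨A, hA⟩ := exists_homeomorph_frame z v w h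
  have hbot : A '' (Icc 0 1 ×ℂ {(0 : ℝ)}) = segment ℝ z (z + v) := by
    rw [image_frame_Icc_const hA]; simp
  have htop : A '' (Icc 0 1 ×ℂ {(1 : ℝ)}) = segment ℝ (z + w) (z + w + v) := by
    rw [image_frame_Icc_const hA]; simp
  have hlft : A '' ({(0 : ℝ)} ×ℂ Icc 0 1) = segment ℝ z (z + w) := by
    rw [image_frame_const_Icc hA]; simp
  have hrgt : A '' ({(1 : ℝ)} ×ℂ Icc 0 1) = segment ℝ (z + v) (z + v + w) := by
    rw [image_frame_const_Icc hA]; simp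
  -- a common point of the two edges would lie in `U`, hence in `S ∩ S' = ∅`
  have key : ∀ {E E' : Set ℂ}, (E = Icc 0 1 ×ℂ {(0 : ℝ)} ∨ E = Icc 0 1 ×ℂ {(1 : ℝ)} ∨
      E = {(0 : ℝ)} ×ℂ Icc 0 1 ∨ E = {(1 : ℝ)} ×ℂ Icc 0 1) →
      S = Subtype.val ⁻¹' (A '' E) → S' = Subtype.val ⁻¹' (A '' E') →
      ∀ c : ℂ, c ∈ E → c ∈ E' → False := by
    intro E E' hE hSE hS'E c hc hc'
    have hcU : A c ∈ U := sq_edge_image_subset h hcl hA hE ⟨c, hc, rfl⟩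
    have hmem : (⟨A c, hcU⟩ : U) ∈ S ∩ S' := by
      rw [hSE, hS'E]
      exact ⟨⟨c, hc, rfl⟩, ⟨c, hc', rfl⟩⟩
    rw [hSS'] at hmem
    exact hmem
  obtain ⟨E, hE, rfl⟩ := (isSide_iff_of_subset hU h𝒬 h𝒮 hQ hQe h hcl hA).1 hS
  obtain ⟨E', hE', rfl⟩ := (isSide_iff_of_subset hU h𝒬 h𝒮 hQ hQe h hcl hA).1 hS'
  rcases hE with rfl | rfl | rfl | rfl <;> rcases hE' with rfl | rfl | rfl | rfl
  -- (bottom, ·)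
  · exact (key (Or.inl rfl) rfl rfl ⟨0, 0⟩ (by simp [mem_reProdIm]) (by simp [mem_reProdIm])).elim
  · exact Or.inl ⟨by rw [hbot], by rw [htop]⟩
  · exact (key (Or.inl rfl) rfl rfl ⟨0, 0⟩ (by simp [mem_reProdIm]) (by simp [mem_reProdIm])).elim
  · exact (key (Or.inl rfl) rfl rfl ⟨1, 0⟩ (by simp [mem_reProdIm]) (by simp [mem_reProdIm])).elim
  -- (top, ·)
  · exact Or.inr (Or.inl ⟨by rw [htop], by rw [hbot]⟩)
  · exact (key (Or.inr (Or.inl rfl)) rfl rfl ⟨0, 1⟩ (by simp [mem_reProdIm])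
      (by simp [mem_reProdIm])).elim
  · exact (key (Or.inr (Or.inl rfl)) rfl rfl ⟨0, 1⟩ (by simp [mem_reProdIm])
      (by simp [mem_reProdIm])).elim
  · exact (key (Or.inr (Or.inl rfl)) rfl rfl ⟨1, 1⟩ (by simp [mem_reProdIm])
      (by simp [mem_reProdIm])).elim
  -- (left, ·)
  · exact (key (Or.inr (Or.inr (Or.inl rfl))) rfl rfl ⟨0, 0⟩ (by simp [mem_reProdIm])
      (by simp [mem_reProdIm])).elim
  · exact (key (Or.inr (Or.inr (Or.inl rfl))) rfl rfl ⟨0, 1⟩ (by simp [mem_reProdIm])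
      (by simp [mem_reProdIm])).elim
  · exact (key (Or.inr (Or.inr (Or.inl rfl))) rfl rfl ⟨0, 0⟩ (by simp [mem_reProdIm])
      (by simp [mem_reProdIm])).elim
  · exact Or.inr (Or.inr (Or.inl ⟨by rw [hlft], by rw [hrgt]⟩))
  -- (right, ·)
  · exact (key (Or.inr (Or.inr (Or.inr rfl))) rfl rfl ⟨1, 0⟩ (by simp [mem_reProdIm])
      (by simp [mem_reProdIm])).elim
  · exact (key (Or.inr (Or.inr (Or.inr rfl))) rfl rfl ⟨1, 1⟩ (by simp [mem_reProdIm])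
      (by simp [mem_reProdIm])).elim
  · exact Or.inr (Or.inr (Or.inr ⟨by rw [hrgt], by rw [hlft]⟩))
  · exact (key (Or.inr (Or.inr (Or.inr rfl))) rfl rfl ⟨1, 0⟩ (by simp [mem_reProdIm])
      (by simp [mem_reProdIm])).elim

/-! ### The characterisation -/

include hU h𝒬 h𝒮 in
/-- **[AbsTopIII] Prop 2.5 (b) at the printed input data — strict parallelism characterised.** For
`U ⊆ ℂ` open and any `𝒮(U) ⊆ 𝒬 ⊆ 𝒫(U)`: `L, L'` are strictly parallel **iff** some member `Q ∈ 𝒬`, presented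
as `openParallelogram z v w` with `v, w` independent and closure in `U`, has the closed edge `[z, z + v]`
inside `L` and the opposite closed edge `[z + w, z + w + v]` inside `L'`.  (⇒: the two disjoint witnessing
sides are an opposite pair of edges, normalised by re-presenting `Q`; ⇐: opposite edges are disjoint sides,
`strictlyParallel_opposite_edges`, and the relation is monotone.)
[cite: MochizukiAbsTopIII2015, Proposition 2.5 (b) p.56] -/
theorem strictlyParallel_iff {L L' : Set U} :
    StrictlyParallel 𝒬 L L' ↔
      ∃ Q ∈ 𝒬, ∃ z v w : ℂ, LinearIndependent ℝ ![v, w] ∧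
        Subtype.val '' Q = openParallelogram z v w ∧ closure (openParallelogram z v w) ⊆ U ∧
        Subtype.val ⁻¹' segment ℝ z (z + v) ⊆ L ∧
        Subtype.val ⁻¹' segment ℝ (z + w) (z + w + v) ⊆ L' := by
  constructor
  · rintro ⟨Q, hQ, S, S', hS, hS', hSS', hSL, hS'L'⟩
    obtain ⟨z, v, w, h, hQe, hcl⟩ := h𝒬 Q hQ
    rw [hQe] at hcl
    refine ⟨Q, hQ, ?_⟩
    rcases eq_opposite_edges_of_isSide_of_inter_eq_empty hU h𝒬 h𝒮 hQ hQe h hcl hS hS' hSS' with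
      ⟨rfl, rfl⟩ | ⟨rfl, rfl⟩ | ⟨rfl, rfl⟩ | ⟨rfl, rfl⟩
    · exact ⟨z, v, w, h, hQe, hcl, hSL, hS'L'⟩
    · -- `[z+w, z+w+v] ⊆ L`, `[z, z+v] ⊆ L'`: present `Q` as `(z + w) + s v + t (−w)`
      refine ⟨z + w, v, -w, linearIndependent_pair_neg_right h,
        hQe.trans (openParallelogram_flip z v w).symm, by rw [openParallelogram_flip]; exact hcl, hSL, ?_⟩
      simpa only [add_neg_cancel_right] using hS'L'
    · -- `[z, z+w] ⊆ L`, `[z+v, z+v+w] ⊆ L'`: present `Q` as `z + s w + t v`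
      refine ⟨z, w, v, LinearIndependent.pair_symm_iff.mp h, hQe.trans (openParallelogram_comm z w v),
        by rw [← openParallelogram_comm z w v]; exact hcl, hSL, hS'L'⟩
    · -- `[z+v, z+v+w] ⊆ L`, `[z, z+w] ⊆ L'`: present `Q` as `(z + v) + s w + t (−v)`
      refine ⟨z + v, w, -v, linearIndependent_pair_neg_right (LinearIndependent.pair_symm_iff.mp h),
        hQe.trans ((openParallelogram_comm z w v).trans (openParallelogram_flip z w v).symm),
        by rw [openParallelogram_flip, ← openParallelogram_comm z w v]; exact hcl, hSL, ?_⟩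
      simpa only [add_neg_cancel_right] using hS'L'
  · rintro ⟨Q, hQ, z, v, w, h, hQe, hcl, hL, hL'⟩
    exact (strictlyParallel_opposite_edges hU h𝒬 h𝒮 hQ hQe h hcl).mono hL hL'

end Planar

/-! ### The two extreme printed models `𝒬 = 𝒫(U)` and `𝒬 = 𝒮(U)` -/

/-- **[AbsTopIII] Prop 2.5 (b) at `𝒬 = 𝒫(U)`** (all pre-compact parallelograms in the open `U ⊆ ℂ`):
`L, L'` are strictly parallel **iff** there is a non-degenerate parallelogram `z + [0,1] v + [0,1] w ⊆ U`
(closed) with `[z, z + v] ⊆ L` and `[z + w, z + w + v] ⊆ L'`.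
[cite: MochizukiAbsTopIII2015, Proposition 2.5 (b) p.56] -/
theorem strictlyParallel_parallelograms_iff {U : Set ℂ} (hU : IsOpen U) {L L' : Set U} :
    StrictlyParallel {Q : Set U | Subtype.val '' Q ∈ parallelogramsIn U} L L' ↔
      ∃ z v w : ℂ, LinearIndependent ℝ ![v, w] ∧ closure (openParallelogram z v w) ⊆ U ∧
        Subtype.val ⁻¹' segment ℝ z (z + v) ⊆ L ∧
        Subtype.val ⁻¹' segment ℝ (z + w) (z + w + v) ⊆ L' := by
  have h𝒬 : ∀ Q ∈ {Q : Set U | Subtype.val '' Q ∈ parallelogramsIn U},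
      Subtype.val '' Q ∈ parallelogramsIn U := fun Q hQ => hQ
  have h𝒮 : ∀ Q : Set U, Subtype.val '' Q ∈ squaresIn U →
      Q ∈ {Q : Set U | Subtype.val '' Q ∈ parallelogramsIn U} :=
    fun Q hQ => squaresIn_subset_parallelogramsIn U hQ
  refine (strictlyParallel_iff hU h𝒬 h𝒮).trans ⟨?_, ?_⟩
  · rintro ⟨Q, -, z, v, w, h, -, hcl, hL, hL'⟩
    exact ⟨z, v, w, h, hcl, hL, hL'⟩
  · rintro ⟨z, v, w, h, hcl, hL, hL'⟩
    have himg := image_val_preimage_val_of_subset (U := U) (subset_closure.trans hcl)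
    exact ⟨Subtype.val ⁻¹' openParallelogram z v w, ⟨z, v, w, h, himg, by rw [himg]; exact hcl⟩,
      z, v, w, h, himg, hcl, hL, hL'⟩

/-- **[AbsTopIII] Prop 2.5 (b) at `𝒬 = 𝒮(U)`** (all pre-compact squares in the open `U ⊆ ℂ` — the
collection the reconstruction is run on): `L, L'` are strictly parallel **iff** there are `z` and `v ≠ 0`
with the closed square `z + [0,1] v + [0,1] iv ⊆ U`, `[z, z + v] ⊆ L` and `[z + iv, z + iv + v] ⊆ L'`.
(Every opposite pair of edges of a square is the pair `{[z, z+v], [z+iv, z+iv+v]}` of a suitable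
presentation of the same square.) [cite: MochizukiAbsTopIII2015, Proposition 2.5 (b) p.56] -/
theorem strictlyParallel_squares_iff {U : Set ℂ} (hU : IsOpen U) {L L' : Set U} :
    StrictlyParallel {Q : Set U | Subtype.val '' Q ∈ squaresIn U} L L' ↔
      ∃ z v : ℂ, v ≠ 0 ∧ closure (openParallelogram z v (I * v)) ⊆ U ∧
        Subtype.val ⁻¹' segment ℝ z (z + v) ⊆ L ∧
        Subtype.val ⁻¹' segment ℝ (z + I * v) (z + I * v + v) ⊆ L' := by
  have h𝒬 : ∀ Q ∈ {Q : Set U | Subtype.val '' Q ∈ squaresIn U}, Subtype.val '' Q ∈ parallelogramsIn U :=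
    fun Q hQ => squaresIn_subset_parallelogramsIn U hQ
  have h𝒮 : ∀ Q : Set U, Subtype.val '' Q ∈ squaresIn U → Q ∈ {Q : Set U | Subtype.val '' Q ∈ squaresIn U} :=
    fun Q hQ => hQ
  constructor
  · rintro ⟨Q, hQ, S, S', hS, hS', hSS', hSL, hS'L'⟩
    obtain ⟨z, v, hv, hQe, hcl⟩ := id hQ
    rw [hQe] at hcl
    have h : LinearIndependent ℝ ![v, I * v] := linearIndependent_pair_mul_I hv
    rcases eq_opposite_edges_of_isSide_of_inter_eq_empty hU h𝒬 h𝒮 hQ hQe h hcl hS hS' hSS' with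
      ⟨rfl, rfl⟩ | ⟨rfl, rfl⟩ | ⟨rfl, rfl⟩ | ⟨rfl, rfl⟩
    · exact ⟨z, v, hv, hcl, hSL, hS'L'⟩
    · -- `[z+iv, z+iv+v] ⊆ L`, `[z, z+v] ⊆ L'`: the square on `[z+v+iv, z+iv]` (edge vector `−v`)
      refine ⟨z + v + I * v, -v, neg_ne_zero.mpr hv,
        by rw [mul_neg, openParallelogram_flip_flip]; exact hcl, ?_, ?_⟩
      · have e : segment ℝ (z + v + I * v) (z + v + I * v + -v) = segment ℝ (z + I * v) (z + I * v + v) := by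
          rw [segment_symm]; congr 1 <;> ring
        rw [e]; exact hSL
      · have e : segment ℝ (z + v + I * v + I * -v) (z + v + I * v + I * -v + -v) = segment ℝ z (z + v) := by
          rw [segment_symm]; congr 1 <;> ring
        rw [e]; exact hS'L'
    · -- `[z, z+iv] ⊆ L`, `[z+v, z+v+iv] ⊆ L'`: the square on `[z+iv, z]` (edge vector `−iv`)
      have hI : I * -(I * v) = v := by rw [mul_neg, ← mul_assoc, I_mul_I]; ring
      refine ⟨z + I * v, -(I * v), neg_ne_zero.mpr (mul_ne_zero I_ne_zero hv), ?_, ?_, ?_⟩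
      · rw [hI, openParallelogram_comm (z + I * v) v (-(I * v)), openParallelogram_flip]; exact hcl
      · have e : segment ℝ (z + I * v) (z + I * v + -(I * v)) = segment ℝ z (z + I * v) := by
          rw [segment_symm]; congr 1; ring
        rw [e]; exact hSL
      · have e : segment ℝ (z + I * v + I * -(I * v)) (z + I * v + I * -(I * v) + -(I * v)) =
            segment ℝ (z + v) (z + v + I * v) := by
          rw [hI, segment_symm]; congr 1 <;> ring
        rw [e]; exact hS'L'
    · -- `[z+v, z+v+iv] ⊆ L`, `[z, z+iv] ⊆ L'`: the square on `[z+v, z+v+iv]` (edge vector `iv`)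
      have hI : I * (I * v) = -v := by rw [← mul_assoc, I_mul_I]; ring
      refine ⟨z + v, I * v, mul_ne_zero I_ne_zero hv, ?_, hSL, ?_⟩
      · rw [hI, openParallelogram_flip z (I * v) v, openParallelogram_comm z v (I * v)]; exact hcl
      · have e : segment ℝ (z + v + I * (I * v)) (z + v + I * (I * v) + I * v) = segment ℝ z (z + I * v) := by
          rw [hI]; congr 1 <;> ring
        rw [e]; exact hS'L'
  · rintro ⟨z, v, hv, hcl, hL, hL'⟩
    have himg := image_val_preimage_val_of_subset (U := U) (subset_closure.trans hcl)
    have hQ : (Subtype.val ⁻¹' openParallelogram z v (I * v) : Set U) ∈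
        {Q : Set U | Subtype.val '' Q ∈ squaresIn U} := ⟨z, v, hv, himg, by rw [himg]; exact hcl⟩
    exact (strictlyParallel_opposite_edges hU h𝒬 h𝒮 hQ himg (linearIndependent_pair_mul_I hv) hcl).mono
      hL hL'

end Parallelograms

end

end Literature.AnabelianGeometry.AbsoluteAnabelian
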